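import Mathlib
import HarnessLib
import Summits.HubbardSuperconductivity.HubbardSuperconductivity.Theorems.KLProgrammeKLRegimeVolumeLimitCutoffDoorsV14

/-!
# Route `KLProgramme` — crux K3, child «VolumeLimit» (stmt-HubbardSuperconductivity-19921 `KLRegimeVolumeLimitV14`, skeleton «cauchy» v2
# 6f46346070479240): the registered stub `stub_vl_rates` IN THE ENGINE'S OWN VARIABLES — SAME-CUTOFF two-volume rates of the finite-`(L, M)`
# Grassmann objects (cell gate-hubbard-kl, seat hubbard-kl-k3c4-p1 g5 = the registrant; `--supports` the VolumeLimit child)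

The v2 stub `stub_vl_rates` (plan g13 (R6); (b1) a two-volume rate of the density `klOccInf L β U μ`, (b2) a two-volume rate with
cross-grid torus modulus of `klSixInf L β U μ n k`) is stated on CUTOFF-FREE Gibbs-state quantities (`M = ∞`, Hamiltonian traces).  Its
owner is the ENGINE lineage, whose objects are the finite-`(L, M)` Grassmann quantities `klSelfEnergy L M …` and the occupation ratio of
`tendsto_occupationRatio_klOccInf`.  This file is the door between the two: **it suffices to compare the two volumes AT THE SAME MATSUBARA
CUTOFF `M`, for all `M` beyond any threshold `M₀(L, L′)` the prover likes** — the cutoff then disappears through k3c5-p3's label-uniform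
`M → ∞` limits (`klSelfEnergy_cutoffLimit_labelUniform`, `tendsto_occupationRatio_klOccInf`, ALL `U`), so that NO comparison of two
different cutoffs `M ≠ M′` (no Matsubara tail) is ever needed on the engine side:

* `kler_norm_sub_le_of_tendsto` — limits inherit eventual bounds on differences;
* `kler_carrierRate_of_sameCutoff` — a same-`M` estimate `‖Σ̂_{L,M}((ω,k),0) − Σ̂_{L′,M}((ω,k′),0)‖ ≤ c` at the label of integer `n`, for
  all large `M`, gives `‖Σ∞^K_L(n,k) − Σ∞^K_{L′}(n,k′)‖ ≤ c` for the cutoff-free carrier `klSelfEnergyInf` (any frame `K`, any real `U`);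
* `kler_occRate_of_sameCutoff` — the same for the occupation ratio ⇒ `‖occ∞(L) − occ∞(L′)‖ ≤ c`;
* `kler_sixRate_of_carrierRate_occRate` — `Six∞ = (Σ∞⁰ − U·occ∞)/U²` (`klSelfEnergyInf_zero_frame`): (b2) from the bare carrier rate and (b1);
* **`stub_vl_rates_of_engineRates`** — the REGISTERED text of `stub_vl_rates` VERBATIM from, under the same binder prefix,
  `∃ L₀ D ρ₁ ρ₂ → 0` with (i) same-cutoff two-volume rate `ρ₁ L` of the occupation ratio and (ii) same-cutoff two-volume rate
  `ρ₂ L + D·Σ_i |p_k i − p′_{k′} i|_𝕋` of the BARE (`K = 0`) last-scale self-energy `klSelfEnergy L M β U μ 0 klE0 (nScales β + 1) (ω, ·) 0`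
  — the form the termwise calculus (`…VolumeLimitGridFamilies`, `twoVolumeRate_of_termwise`) produces: each term of the expansion at
  `(L, M)` and `(L′, M)` is a loop average over grids of the SAME Matsubara range.

Everything is proved; no definitions; nothing is asserted about the model.
-/

noncomputable section

namespace Summit.HubbardSuperconductivity.HubbardSuperconductivity.Theorems.KLRegimeVolumeLimit

set_option linter.dupNamespace false -- summit = problem name (single-conjunct summit), D-0017

open Filter Topology Finset Literature.MathematicalPhysics.QuantumLattice Literature.Probability.LatticeModels GrassmannAlgebra
open Summit.HubbardSuperconductivity.HubbardSuperconductivity.Theorems.KLProgrammeLegKernels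
open Summit.HubbardSuperconductivity.HubbardSuperconductivity.Theorems.KLRegimeSplit
open Summit.HubbardSuperconductivity.HubbardSuperconductivity.Theorems.TwoPointAssembly

/-! ## §1 Limits inherit eventual bounds -/

/-- If `a M → A`, `b M → B` and eventually `‖a M − b M‖ ≤ c`, then `‖A − B‖ ≤ c`. -/
theorem kler_norm_sub_le_of_tendsto {a b : ℕ → ℂ} {A B : ℂ} (ha : Tendsto a atTop (𝓝 A)) (hb : Tendsto b atTop (𝓝 B))
    {c : ℝ} (h : ∀ᶠ M in atTop, ‖a M - b M‖ ≤ c) : ‖A - B‖ ≤ c :=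
  le_of_tendsto ((ha.sub hb).norm) h

/-! ## §2 The cutoff-free carrier from same-cutoff estimates -/

/-- **Same-cutoff two-volume estimate ⇒ cutoff-free two-volume estimate of the carrier** (`β > 0`, `3 ≤ L, L′`, any real `U`, any frame
`K`, spin `0` on the finite side): if for all large `M` and every Matsubara label `ω` of integer `n`,
`‖klSelfEnergy L M …K… (ω, k) 0 − klSelfEnergy L′ M …K… (ω, k′) 0‖ ≤ c`, then `‖klSelfEnergyInf L …K n k − klSelfEnergyInf L′ …K n k′‖ ≤ c`
(both finite objects are within `ε` of their cutoff-free limits, label-uniformly: `klSelfEnergy_cutoffLimit_labelUniform`). -/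
theorem kler_carrierRate_of_sameCutoff {β : ℝ} (hβ : 0 < β) (U μ : ℝ) (K : TrigPolyC4v) {L L' : ℕ} [NeZero L] [NeZero L']
    (hL : 3 ≤ L) (hL' : 3 ≤ L') {n : ℤ} {k : TorusSite 2 L} {k' : TorusSite 2 L'} {c : ℝ}
    (h : ∃ M₀ : ℕ, ∀ (M : ℕ) [NeZero M], M₀ ≤ M → ∀ ω : MatsubaraIdx M, matsubaraInt M ω = n →
      ‖klSelfEnergy L M β U μ K klE0 (nScales β + 1) (ω, k) 0 - klSelfEnergy L' M β U μ K klE0 (nScales β + 1) (ω, k') 0‖ ≤ c) :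
    ‖klSelfEnergyInf L β U μ K n k - klSelfEnergyInf L' β U μ K n k'‖ ≤ c := by
  obtain ⟨M₀, hM₀⟩ := h
  refine le_of_forall_pos_le_add fun ε hε => ?_
  obtain ⟨M₁, hM₁⟩ := klSelfEnergy_cutoffLimit_labelUniform hL hβ U μ K (half_pos hε)
  obtain ⟨M₁', hM₁'⟩ := klSelfEnergy_cutoffLimit_labelUniform hL' hβ U μ K (half_pos hε)
  -- a common cutoff beyond all thresholds and beyond `|n|`
  set M : ℕ := max (max M₀ (max M₁ M₁')) (n.natAbs + 1) with hM
  haveI : NeZero M := ⟨by omega⟩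
  have hnM : n.natAbs < M := by omega
  obtain ⟨ω, hω⟩ := klvc_exists_matsubaraIdx hnM
  have h0 := hM₀ M (by omega) ω hω
  have h1 := hM₁ M (by omega) ω k 0
  have h1' := hM₁' M (by omega) ω k' 0
  rw [hω] at h1 h1'
  calc ‖klSelfEnergyInf L β U μ K n k - klSelfEnergyInf L' β U μ K n k'‖
      = ‖(klSelfEnergy L M β U μ K klE0 (nScales β + 1) (ω, k) 0 - klSelfEnergy L' M β U μ K klE0 (nScales β + 1) (ω, k') 0) -
          (klSelfEnergy L M β U μ K klE0 (nScales β + 1) (ω, k) 0 - klSelfEnergyInf L β U μ K n k) +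
          (klSelfEnergy L' M β U μ K klE0 (nScales β + 1) (ω, k') 0 - klSelfEnergyInf L' β U μ K n k')‖ := by
        congr 1; ring
    _ ≤ ‖klSelfEnergy L M β U μ K klE0 (nScales β + 1) (ω, k) 0 - klSelfEnergy L' M β U μ K klE0 (nScales β + 1) (ω, k') 0‖ +
          ‖klSelfEnergy L M β U μ K klE0 (nScales β + 1) (ω, k) 0 - klSelfEnergyInf L β U μ K n k‖ +
          ‖klSelfEnergy L' M β U μ K klE0 (nScales β + 1) (ω, k') 0 - klSelfEnergyInf L' β U μ K n k'‖ := by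
        exact (norm_add_le _ _).trans (add_le_add (norm_sub_le _ _) le_rfl)
    _ ≤ c + ε / 2 + ε / 2 := add_le_add_three h0 h1 h1'
    _ = c + ε := by ring

/-! ## §3 The density from same-cutoff estimates of the occupation ratio -/

/-- **Same-cutoff two-volume estimate of the occupation ratio ⇒ two-volume estimate of the density `occ∞`** (`β > 0`, `3 ≤ L, L′`, any
real `U`): the occupation ratios converge to `klOccInf` at each volume (`tendsto_occupationRatio_klOccInf`), so an eventual bound on their
difference passes to the limits. -/
theorem kler_occRate_of_sameCutoff {β : ℝ} (hβ : 0 < β) (U μ : ℝ) {L L' : ℕ} [NeZero L] [NeZero L'] (hL : 3 ≤ L) (hL' : 3 ≤ L')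
    {c : ℝ}
    (h : ∃ M₀ : ℕ, ∀ M : ℕ, M₀ ≤ M →
      ‖(((1 / (β * (L : ℝ) ^ 2) ^ 2 : ℝ) : ℂ)) *
            (∑ q : FreqMomentum L M,
              gaussExpect ℂ (hubbardCovariance L M β μ 0)
                (gen ℂ (((q, (1 : Fin 2)), 0) : HubbardFieldIdx L M) * gen ℂ (((q, (1 : Fin 2)), 1) : HubbardFieldIdx L M) *
                  grassmannExp (-(hubbardInteraction L M β U)))) /
          effPartitionFn ℂ (hubbardCovariance L M β μ 0) (hubbardInteraction L M β U) -
        (((1 / (β * (L' : ℝ) ^ 2) ^ 2 : ℝ) : ℂ)) *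
            (∑ q : FreqMomentum L' M,
              gaussExpect ℂ (hubbardCovariance L' M β μ 0)
                (gen ℂ (((q, (1 : Fin 2)), 0) : HubbardFieldIdx L' M) * gen ℂ (((q, (1 : Fin 2)), 1) : HubbardFieldIdx L' M) *
                  grassmannExp (-(hubbardInteraction L' M β U)))) /
          effPartitionFn ℂ (hubbardCovariance L' M β μ 0) (hubbardInteraction L' M β U)‖ ≤ c) :
    ‖klOccInf L β U μ - klOccInf L' β U μ‖ ≤ c := by
  obtain ⟨M₀, hM₀⟩ := h
  exact kler_norm_sub_le_of_tendsto (tendsto_occupationRatio_klOccInf hL hβ U μ) (tendsto_occupationRatio_klOccInf hL' hβ U μ)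
    (eventually_atTop.2 ⟨M₀, hM₀⟩)

/-! ## §4 The six-point coefficient from the bare carrier and the density -/

/-- **`Six∞ = (Σ∞⁰ − U·occ∞)/U²`**: a two-volume estimate `cS` of the bare cutoff-free carrier and `c₁` of the density give
`‖Six∞_L(n,k) − Six∞_{L′}(n,k′)‖ ≤ (cS + |U|·c₁)/U²` (`U ≠ 0`, `β ≠ 0`). -/
theorem kler_sixRate_of_carrierRate_occRate {β : ℝ} (hβ : β ≠ 0) {U : ℝ} (hU : U ≠ 0) (μ : ℝ) {L L' : ℕ} [NeZero L] [NeZero L']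
    {n : ℤ} {k : TorusSite 2 L} {k' : TorusSite 2 L'} {cS c₁ : ℝ}
    (hS : ‖klSelfEnergyInf L β U μ 0 n k - klSelfEnergyInf L' β U μ 0 n k'‖ ≤ cS)
    (hocc : ‖klOccInf L β U μ - klOccInf L' β U μ‖ ≤ c₁) :
    ‖klSixInf L β U μ n k - klSixInf L' β U μ n k'‖ ≤ (cS + |U| * c₁) / U ^ 2 := by
  have hU2 : (0 : ℝ) < U ^ 2 := by positivity
  have hUc : ((U : ℂ) ^ 2) ≠ 0 := pow_ne_zero 2 (by exact_mod_cast hU)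
  rw [klSelfEnergyInf_zero_frame hβ, klSelfEnergyInf_zero_frame hβ] at hS
  -- `U²·(Six − Six′) = (Σ − Σ′) − U·(occ − occ′)`
  have hid : klSixInf L β U μ n k - klSixInf L' β U μ n k' =
      (((U : ℂ) * klOccInf L β U μ + (U : ℂ) ^ 2 * klSixInf L β U μ n k) -
          ((U : ℂ) * klOccInf L' β U μ + (U : ℂ) ^ 2 * klSixInf L' β U μ n k') -
        (U : ℂ) * (klOccInf L β U μ - klOccInf L' β U μ)) / (U : ℂ) ^ 2 := by
    rw [eq_div_iff hUc]
    ring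
  rw [hid, norm_div, norm_pow, Complex.norm_real, Real.norm_eq_abs, sq_abs, div_le_div_iff_of_pos_right hU2]
  refine (norm_sub_le _ _).trans (add_le_add hS ?_)
  rw [norm_mul, Complex.norm_real, Real.norm_eq_abs]
  exact mul_le_mul_of_nonneg_left hocc (abs_nonneg U)

/-! ## §5 The registered stub `stub_vl_rates` from same-cutoff engine rates -/

/-- **DOOR: `stub_vl_rates` (skeleton «cauchy» v2 of 19921) VERBATIM from SAME-CUTOFF ENGINE RATES.**  If, under the stub's own binder
prefix (tower of an admissible frame in the KL regime), there are `L₀`, a modulus constant `D` and rates `ρ₁, ρ₂ → 0` such that for all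
`L₀ ≤ L ≤ L′` and all cutoffs `M` beyond some `M₀(L, L′)`: (i) the occupation ratios at `(L, M)` and `(L′, M)` differ by at most `ρ₁ L`,
and (ii) the BARE last-scale self-energies at `(L, M)` and `(L′, M)` (frame `0`, spin `0`, the same Matsubara label, any torus momenta)
differ by at most `ρ₂ L + D·Σ_i |p_k i − p′_{k′} i|_𝕋` — then (b1) and (b2) hold as registered, with `D₂ = D/U²`,
`ρ₂′ = (ρ₂ + |U|ρ₁)/U²`, threshold `max L₀ 3`. -/
theorem stub_vl_rates_of_engineRates
    (heng : ∀ (G : GeoConsts) (P : SplitConsts) (Q : EngConsts) (R : RenConsts), G.WF → P.WF → Q.WF → R.WF →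
      ∃ c₅ : ℝ, 0 < c₅ ∧ ∀ c : ℝ, 0 < c → c ≤ c₅ → ∃ U₀ : ℝ, 0 < U₀ ∧
        ∀ μ ∈ klWindowC, ∀ U : ℝ, 0 < U → U ≤ U₀ → ∀ β : ℝ, klBetaMin ≤ β → β ≤ Real.exp (c / U ^ 2) →
          ∀ K : TrigPolyC4v, klPredsV14.frameOK R U (nScales β) μ K →
            ∀ (Lstar : ℕ) (Mstar : ℕ → ℕ), TowerP klPredsV14 G P Q R β U μ K Lstar Mstar →
              ∃ L₀ : ℕ, ∃ D : ℝ, ∃ ρ₁ : ℕ → ℝ, ∃ ρ₂ : ℕ → ℝ, Tendsto ρ₁ atTop (𝓝 0) ∧ Tendsto ρ₂ atTop (𝓝 0) ∧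
                (∀ (L : ℕ) [NeZero L], L₀ ≤ L → ∀ (L' : ℕ) [NeZero L'], L ≤ L' → ∃ M₀ : ℕ, ∀ M : ℕ, M₀ ≤ M →
                  ‖(((1 / (β * (L : ℝ) ^ 2) ^ 2 : ℝ) : ℂ)) *
                        (∑ q : FreqMomentum L M,
                          gaussExpect ℂ (hubbardCovariance L M β μ 0)
                            (gen ℂ (((q, (1 : Fin 2)), 0) : HubbardFieldIdx L M) * gen ℂ (((q, (1 : Fin 2)), 1) : HubbardFieldIdx L M) *
                              grassmannExp (-(hubbardInteraction L M β U)))) /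
                      effPartitionFn ℂ (hubbardCovariance L M β μ 0) (hubbardInteraction L M β U) -
                    (((1 / (β * (L' : ℝ) ^ 2) ^ 2 : ℝ) : ℂ)) *
                        (∑ q : FreqMomentum L' M,
                          gaussExpect ℂ (hubbardCovariance L' M β μ 0)
                            (gen ℂ (((q, (1 : Fin 2)), 0) : HubbardFieldIdx L' M) *
                                gen ℂ (((q, (1 : Fin 2)), 1) : HubbardFieldIdx L' M) *
                              grassmannExp (-(hubbardInteraction L' M β U)))) /
                      effPartitionFn ℂ (hubbardCovariance L' M β μ 0) (hubbardInteraction L' M β U)‖ ≤ ρ₁ L) ∧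
                (∀ (L : ℕ) [NeZero L], L₀ ≤ L → ∀ (L' : ℕ) [NeZero L'], L ≤ L' → ∃ M₀ : ℕ, ∀ (M : ℕ) [NeZero M], M₀ ≤ M →
                  ∀ (ω : MatsubaraIdx M) (k : TorusSite 2 L) (k' : TorusSite 2 L'),
                    ‖klSelfEnergy L M β U μ 0 klE0 (nScales β + 1) (ω, k) 0 -
                        klSelfEnergy L' M β U μ 0 klE0 (nScales β + 1) (ω, k') 0‖ ≤
                      ρ₂ L + D * ∑ i, torusAbs (latticeMomentum L k i - latticeMomentum L' k' i))) :
    ∀ (G : GeoConsts) (P : SplitConsts) (Q : EngConsts) (R : RenConsts), G.WF → P.WF → Q.WF → R.WF →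
      ∃ c₅ : ℝ, 0 < c₅ ∧ ∀ c : ℝ, 0 < c → c ≤ c₅ → ∃ U₀ : ℝ, 0 < U₀ ∧
        ∀ μ ∈ klWindowC, ∀ U : ℝ, 0 < U → U ≤ U₀ → ∀ β : ℝ, klBetaMin ≤ β → β ≤ Real.exp (c / U ^ 2) →
          ∀ K : TrigPolyC4v, klPredsV14.frameOK R U (nScales β) μ K →
            ∀ (Lstar : ℕ) (Mstar : ℕ → ℕ), TowerP klPredsV14 G P Q R β U μ K Lstar Mstar →
              ∃ L₀ : ℕ, ∃ D₂ : ℝ, ∃ ρ₁ : ℕ → ℝ, ∃ ρ₂ : ℕ → ℝ, Tendsto ρ₁ atTop (𝓝 0) ∧ Tendsto ρ₂ atTop (𝓝 0) ∧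
                (∀ (L : ℕ) [NeZero L], L₀ ≤ L → ∀ (L' : ℕ) [NeZero L'], L ≤ L' → ‖klOccInf L β U μ - klOccInf L' β U μ‖ ≤ ρ₁ L) ∧
                (∀ (L : ℕ) [NeZero L], L₀ ≤ L → ∀ (L' : ℕ) [NeZero L'], L ≤ L' →
                  ∀ (n : ℤ) (k : TorusSite 2 L) (k' : TorusSite 2 L'),
                    ‖klSixInf L β U μ n k - klSixInf L' β U μ n k'‖ ≤
                      ρ₂ L + D₂ * ∑ i, torusAbs (latticeMomentum L k i - latticeMomentum L' k' i)) := by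
  intro G P Q R hG hP hQ hR
  obtain ⟨c₅, hc₅, hc⟩ := heng G P Q R hG hP hQ hR
  refine ⟨c₅, hc₅, fun c hc0 hcc => ?_⟩
  obtain ⟨U₀, hU₀, hU⟩ := hc c hc0 hcc
  refine ⟨U₀, hU₀, fun μ hμ U hU0 hUU β hβmin hβmax K hK Lstar Mstar hT => ?_⟩
  have hβ : 0 < β := KLRegimeSplit.pos_of_klBetaMin_le hβmin
  obtain ⟨L₀, D, ρ₁, ρ₂, hρ₁, hρ₂, hocc, hS⟩ := hU μ hμ U hU0 hUU β hβmin hβmax K hK Lstar Mstar hT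
  refine ⟨max L₀ 3, D / U ^ 2, ρ₁, fun L => (ρ₂ L + |U| * ρ₁ L) / U ^ 2, hρ₁, ?_, ?_, ?_⟩
  · have h := ((hρ₂.add (hρ₁.const_mul |U|)).div_const (U ^ 2))
    simpa using h
  · intro L _ hL L' _ hLL'
    have hL3 : 3 ≤ L := le_of_max_le_right hL
    exact kler_occRate_of_sameCutoff hβ U μ hL3 (hL3.trans hLL') (hocc L (le_of_max_le_left hL) L' hLL')
  · intro L _ hL L' _ hLL' n k k'
    have hL3 : 3 ≤ L := le_of_max_le_right hL
    obtain ⟨M₀, hM₀⟩ := hS L (le_of_max_le_left hL) L' hLL'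
    have hcar : ‖klSelfEnergyInf L β U μ 0 n k - klSelfEnergyInf L' β U μ 0 n k'‖ ≤
        ρ₂ L + D * ∑ i, torusAbs (latticeMomentum L k i - latticeMomentum L' k' i) :=
      kler_carrierRate_of_sameCutoff hβ U μ 0 hL3 (hL3.trans hLL') ⟨M₀, fun M _ hM ω _ => hM₀ M hM ω k k'⟩
    have hoc : ‖klOccInf L β U μ - klOccInf L' β U μ‖ ≤ ρ₁ L :=
      kler_occRate_of_sameCutoff hβ U μ hL3 (hL3.trans hLL') (hocc L (le_of_max_le_left hL) L' hLL')
    have h := kler_sixRate_of_carrierRate_occRate hβ.ne' hU0.ne' μ hcar hoc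
    calc _ ≤ (ρ₂ L + D * ∑ i, torusAbs (latticeMomentum L k i - latticeMomentum L' k' i) + |U| * ρ₁ L) / U ^ 2 := h
      _ = (ρ₂ L + |U| * ρ₁ L) / U ^ 2 + D / U ^ 2 * ∑ i, torusAbs (latticeMomentum L k i - latticeMomentum L' k' i) := by ring

end Summit.HubbardSuperconductivity.HubbardSuperconductivity.Theorems.KLRegimeVolumeLimit

end
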